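import Mathlib
import HarnessLib
import Summits.CriticalPhenomena.Ising3DConformalLimit.Theorems.BernsteinTemperaturePlanarPressureAMHyper

/-!
# Route BernsteinTemperature, item `PlanarPressureAM` — file E: the pullback `w ↦ x(w)`

Helper file (supports item `stmt-CriticalPhenomena-10768`). With `x(w) = 16 w (1-w)² / (1+w)⁴`
(so that `x(tanh² β) = κ² = 4 sinh² 2β / cosh⁴ 2β`, Onsager's modulus) we prove, on the interval
`J = (-1/32, 3 - 2√2)` (`3 - 2√2 = tanh² β_c`):

* `|x(w)| < 1`, `1 - x(w) = (1 - 6w + w²)² / (1+w)⁴`, the derivatives `x'`, `x''`;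
* for a coefficient sequence `c` with `|cₙ| ≤ 1` and the `₂F₁(½,½;1;·)` ratio: `Y = G ∘ x`
  (`G = ∑ cₙ zⁿ`) is analytic on `J` and satisfies the pulled-back hypergeometric equation
  `p₂ Y'' + p₁ Y' + p₀ Y = 0`, `p₂ = w-5w²-6w³+6w⁴+5w⁵-w⁶`, `p₁ = 1-15w+12w²+24w³-5w⁴-w⁵`,
  `p₀ = -4+28w-28w²+4w³`;
* `R(w) = log((1+w)/(1-w)) - Φ(x(w))/4` (`Φ = ∑ cₙ zⁿ/n`) is analytic on `J` and
  `4 w (1 - w²) R'(w) = 8 w - (1 - 6w + w²) (Y(w) - c₀)`.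

No definitions are introduced.
-/

namespace Summit.CriticalPhenomena.Ising3DConformalLimit.Theorems

open Filter Topology FormalMultilinearSeries Set
open scoped ENNReal NNReal

/-- `x'(w) = 16 (1-w)(1-6w+w²)/(1+w)⁵`. [folklore] -/
theorem planarPressureAM_x_hasDerivAt (w : ℝ) (hw : 1 + w ≠ 0) :
    HasDerivAt (fun w : ℝ => 16 * w * (1 - w) ^ 2 / (1 + w) ^ 4)
      (16 * (1 - w) * (1 - 6 * w + w ^ 2) / (1 + w) ^ 5) w := by
  have h1 : HasDerivAt (fun w : ℝ => 16 * w * (1 - w) ^ 2)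
      (16 * 1 * (1 - w) ^ 2 + 16 * w * (2 * (1 - w) ^ 1 * (0 - 1))) w := by
    have ha : HasDerivAt (fun w : ℝ => 16 * w) (16 * 1) w := (hasDerivAt_id' w).const_mul 16
    have hb : HasDerivAt (fun w : ℝ => (1 - w) ^ 2) (2 * (1 - w) ^ 1 * (0 - 1)) w :=
      ((hasDerivAt_const w (1 : ℝ)).sub (hasDerivAt_id' w)).pow 2
    exact ha.mul hb
  have h2 : HasDerivAt (fun w : ℝ => (1 + w) ^ 4) (4 * (1 + w) ^ 3 * (0 + 1)) w :=
    ((hasDerivAt_const w (1 : ℝ)).add (hasDerivAt_id' w)).pow 4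
  have h := h1.div h2 (pow_ne_zero 4 hw)
  refine h.congr_deriv ?_
  field_simp
  ring

/-- `x''(w) = 32 (w³ - 12w² + 21w - 6)/(1+w)⁶`. [folklore] -/
theorem planarPressureAM_x'_hasDerivAt (w : ℝ) (hw : 1 + w ≠ 0) :
    HasDerivAt (fun w : ℝ => 16 * (1 - w) * (1 - 6 * w + w ^ 2) / (1 + w) ^ 5)
      (32 * (w ^ 3 - 12 * w ^ 2 + 21 * w - 6) / (1 + w) ^ 6) w := by
  have h1 : HasDerivAt (fun w : ℝ => 16 * (1 - w) * (1 - 6 * w + w ^ 2))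
      (16 * (0 - 1) * (1 - 6 * w + w ^ 2) + 16 * (1 - w) * (0 - 6 * 1 + 2 * w ^ 1 * 1)) w := by
    have ha : HasDerivAt (fun w : ℝ => 16 * (1 - w)) (16 * (0 - 1)) w :=
      ((hasDerivAt_const w (1 : ℝ)).sub (hasDerivAt_id' w)).const_mul 16
    have hb : HasDerivAt (fun w : ℝ => 1 - 6 * w + w ^ 2) (0 - 6 * 1 + 2 * w ^ 1 * 1) w :=
      ((hasDerivAt_const w (1 : ℝ)).sub ((hasDerivAt_id' w).const_mul 6)).add
        ((hasDerivAt_id' w).pow 2)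
    exact ha.mul hb
  have h2 : HasDerivAt (fun w : ℝ => (1 + w) ^ 5) (5 * (1 + w) ^ 4 * (0 + 1)) w :=
    ((hasDerivAt_const w (1 : ℝ)).add (hasDerivAt_id' w)).pow 5
  have h := h1.div h2 (pow_ne_zero 5 hw)
  refine h.congr_deriv ?_
  field_simp
  ring

/-- `1 - x(w) = (1-6w+w²)²/(1+w)⁴`. [folklore] -/
theorem planarPressureAM_one_sub_x (w : ℝ) (hw : 1 + w ≠ 0) :
    1 - 16 * w * (1 - w) ^ 2 / (1 + w) ^ 4 = (1 - 6 * w + w ^ 2) ^ 2 / (1 + w) ^ 4 := by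
  field_simp
  ring

/-- Elementary facts on `J = (-1/32, 3 - 2√2)`: `0 < 1 + w`, `0 < 1 - w`, `0 < 1 - 6w + w²` and
`|x(w)| < 1`. [folklore] -/
theorem planarPressureAM_J_facts {w : ℝ} (hw : w ∈ Ioo (-(1 / 32 : ℝ)) (3 - 2 * Real.sqrt 2)) :
    0 < 1 + w ∧ 0 < 1 - w ∧ 0 < 1 - 6 * w + w ^ 2 ∧
      |16 * w * (1 - w) ^ 2 / (1 + w) ^ 4| < 1 := by
  obtain ⟨hw1, hw2⟩ := hw
  have hs2 : (1.41421 : ℝ) < Real.sqrt 2 := by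
    rw [Real.lt_sqrt (by norm_num)]; norm_num
  have hs2' : Real.sqrt 2 < (1.41422 : ℝ) := by
    rw [Real.sqrt_lt' (by norm_num)]; norm_num
  have hwc : w < 0.1716 := by linarith
  have h1 : 0 < 1 + w := by linarith
  have h2 : 0 < 1 - w := by linarith
  have h3 : 0 < 1 - 6 * w + w ^ 2 := by
    have hsq : Real.sqrt 2 ^ 2 = 2 := Real.sq_sqrt (by norm_num)
    have : 2 * Real.sqrt 2 < 3 - w := by linarith
    nlinarith
  refine ⟨h1, h2, h3, ?_⟩
  rw [abs_lt]
  constructor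
  · -- `-1 < x(w)`: only an issue for `w < 0`
    rw [lt_div_iff₀ (by positivity)]
    by_cases hw0 : 0 ≤ w
    · have : 0 ≤ 16 * w * (1 - w) ^ 2 := by positivity
      have : 0 < (1 + w) ^ 4 := by positivity
      linarith
    · have hw0 : w < 0 := lt_of_not_ge hw0
      have ha : (31 / 32 : ℝ) ^ 4 ≤ (1 + w) ^ 4 :=
        pow_le_pow_left₀ (by norm_num) (by linarith) 4
      have hb : 16 * (-w) * (1 - w) ^ 2 ≤ 16 * (1 / 32) * (33 / 32) ^ 2 := by
        have : (1 - w) ^ 2 ≤ (33 / 32) ^ 2 := pow_le_pow_left₀ h2.le (by linarith) 2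
        have : 0 ≤ (1 - w) ^ 2 := by positivity
        nlinarith
      nlinarith
  · rw [div_lt_iff₀ (by positivity)]
    have := planarPressureAM_one_sub_x w h1.ne'
    have hpos : 0 < (1 - 6 * w + w ^ 2) ^ 2 / (1 + w) ^ 4 := by positivity
    have key : 16 * w * (1 - w) ^ 2 / (1 + w) ^ 4 < 1 := by linarith
    rwa [div_lt_iff₀ (by positivity)] at key

/-- `Y = G ∘ x` is analytic on `J` (`G = ∑ cₙ zⁿ`, `|cₙ| ≤ 1`). [folklore] -/
theorem planarPressureAM_Y_analyticAt (c : ℕ → ℝ) (hle : ∀ n, |c n| ≤ 1) {w : ℝ}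
    (hw : w ∈ Ioo (-(1 / 32 : ℝ)) (3 - 2 * Real.sqrt 2)) :
    AnalyticAt ℝ (fun w : ℝ => ∑' n, c n * (16 * w * (1 - w) ^ 2 / (1 + w) ^ 4) ^ n) w := by
  obtain ⟨h1, -, -, hx⟩ := planarPressureAM_J_facts hw
  have hG : AnalyticAt ℝ (fun z : ℝ => ∑' n, c n * z ^ n) (16 * w * (1 - w) ^ 2 / (1 + w) ^ 4) := by
    apply (planarPressureAM_G_onBall c hle).analyticAt_of_mem
    rw [Metric.mem_eball, edist_lt_ofReal, dist_zero_right, Real.norm_eq_abs]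
    exact hx
  have hxA : AnalyticAt ℝ (fun w : ℝ => 16 * w * (1 - w) ^ 2 / (1 + w) ^ 4) w := by
    fun_prop (disch := exact pow_ne_zero 4 h1.ne')
  exact AnalyticAt.comp (g := fun z : ℝ => ∑' n, c n * z ^ n)
    (f := fun w : ℝ => 16 * w * (1 - w) ^ 2 / (1 + w) ^ 4) hG hxA

/-- First derivative of `Y = G ∘ x` on `J` (chain rule). [folklore] -/
theorem planarPressureAM_Y_hasDerivAt (c : ℕ → ℝ) (hle : ∀ n, |c n| ≤ 1) {w : ℝ}
    (hw : w ∈ Ioo (-(1 / 32 : ℝ)) (3 - 2 * Real.sqrt 2)) :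
    HasDerivAt (fun w : ℝ => ∑' n, c n * (16 * w * (1 - w) ^ 2 / (1 + w) ^ 4) ^ n)
      (deriv (fun z : ℝ => ∑' n, c n * z ^ n) (16 * w * (1 - w) ^ 2 / (1 + w) ^ 4)
        * (16 * (1 - w) * (1 - 6 * w + w ^ 2) / (1 + w) ^ 5)) w := by
  obtain ⟨h1, -, -, hx⟩ := planarPressureAM_J_facts hw
  have hG : AnalyticAt ℝ (fun z : ℝ => ∑' n, c n * z ^ n) (16 * w * (1 - w) ^ 2 / (1 + w) ^ 4) := by
    apply (planarPressureAM_G_onBall c hle).analyticAt_of_mem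
    rw [Metric.mem_eball, edist_lt_ofReal, dist_zero_right, Real.norm_eq_abs]
    exact hx
  exact hG.differentiableAt.hasDerivAt.comp w (planarPressureAM_x_hasDerivAt w h1.ne')

/-- Second derivative of `Y = G ∘ x` on `J`. [folklore] -/
theorem planarPressureAM_Y_deriv_hasDerivAt (c : ℕ → ℝ) (hle : ∀ n, |c n| ≤ 1) {w : ℝ}
    (hw : w ∈ Ioo (-(1 / 32 : ℝ)) (3 - 2 * Real.sqrt 2)) :
    HasDerivAt (deriv (fun w : ℝ => ∑' n, c n * (16 * w * (1 - w) ^ 2 / (1 + w) ^ 4) ^ n))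
      (deriv (deriv (fun z : ℝ => ∑' n, c n * z ^ n)) (16 * w * (1 - w) ^ 2 / (1 + w) ^ 4)
          * (16 * (1 - w) * (1 - 6 * w + w ^ 2) / (1 + w) ^ 5)
          * (16 * (1 - w) * (1 - 6 * w + w ^ 2) / (1 + w) ^ 5)
        + deriv (fun z : ℝ => ∑' n, c n * z ^ n) (16 * w * (1 - w) ^ 2 / (1 + w) ^ 4)
          * (32 * (w ^ 3 - 12 * w ^ 2 + 21 * w - 6) / (1 + w) ^ 6)) w := by
  obtain ⟨h1, -, -, hx⟩ := planarPressureAM_J_facts hw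
  -- `deriv Y` agrees near `w` with `w ↦ G'(x w) · x'(w)`
  have hopen : IsOpen (Ioo (-(1 / 32 : ℝ)) (3 - 2 * Real.sqrt 2)) := isOpen_Ioo
  have hev : deriv (fun w : ℝ => ∑' n, c n * (16 * w * (1 - w) ^ 2 / (1 + w) ^ 4) ^ n)
      =ᶠ[𝓝 w] fun w => deriv (fun z : ℝ => ∑' n, c n * z ^ n)
        (16 * w * (1 - w) ^ 2 / (1 + w) ^ 4) * (16 * (1 - w) * (1 - 6 * w + w ^ 2) / (1 + w) ^ 5) := by
    filter_upwards [hopen.mem_nhds hw] with v hv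
    exact (planarPressureAM_Y_hasDerivAt c hle hv).deriv
  rw [hev.hasDerivAt_iff]
  -- differentiate the product
  have hG1 := planarPressureAM_deriv_onBall (planarPressureAM_G_onBall c hle)
  have hmem : 16 * w * (1 - w) ^ 2 / (1 + w) ^ 4 ∈ Metric.eball (0 : ℝ) (ENNReal.ofReal 1) := by
    rw [Metric.mem_eball, edist_lt_ofReal, dist_zero_right, Real.norm_eq_abs]
    exact hx
  have hA : HasDerivAt (deriv (fun z : ℝ => ∑' n, c n * z ^ n))
      (deriv (deriv (fun z : ℝ => ∑' n, c n * z ^ n)) (16 * w * (1 - w) ^ 2 / (1 + w) ^ 4))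
      (16 * w * (1 - w) ^ 2 / (1 + w) ^ 4) :=
    (hG1.analyticAt_of_mem hmem).differentiableAt.hasDerivAt
  have hcomp := hA.comp w (planarPressureAM_x_hasDerivAt w h1.ne')
  have hprod := hcomp.mul (planarPressureAM_x'_hasDerivAt w h1.ne')
  exact hprod

/-- The pulled-back hypergeometric equation for `Y = G ∘ x` on `J`:
`p₂ Y'' + p₁ Y' + p₀ Y = 0`. Proof: chain rule and the rational identities
`p₂ x'² = μ x(1-x)`, `p₂ x'' + p₁ x' = μ (1-2x)`, `p₀ = -μ/4`, `μ = 16(1-w)(1-6w+w²)`.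
[folklore] -/
theorem planarPressureAM_Y_ode (c : ℕ → ℝ) (hle : ∀ n, |c n| ≤ 1)
    (hratio : ∀ n : ℕ, 4 * ((n : ℝ) + 1) ^ 2 * c (n + 1) = (2 * (n : ℝ) + 1) ^ 2 * c n) {w : ℝ}
    (hw : w ∈ Ioo (-(1 / 32 : ℝ)) (3 - 2 * Real.sqrt 2)) :
    (w - 5 * w ^ 2 - 6 * w ^ 3 + 6 * w ^ 4 + 5 * w ^ 5 - w ^ 6)
        * deriv (deriv (fun w : ℝ => ∑' n, c n * (16 * w * (1 - w) ^ 2 / (1 + w) ^ 4) ^ n)) w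
      + (1 - 15 * w + 12 * w ^ 2 + 24 * w ^ 3 - 5 * w ^ 4 - w ^ 5)
        * deriv (fun w : ℝ => ∑' n, c n * (16 * w * (1 - w) ^ 2 / (1 + w) ^ 4) ^ n) w
      + (-4 + 28 * w - 28 * w ^ 2 + 4 * w ^ 3)
        * (∑' n, c n * (16 * w * (1 - w) ^ 2 / (1 + w) ^ 4) ^ n) = 0 := by
  obtain ⟨h1, -, -, hx⟩ := planarPressureAM_J_facts hw
  rw [(planarPressureAM_Y_deriv_hasDerivAt c hle hw).deriv, (planarPressureAM_Y_hasDerivAt c hle hw).deriv]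
  have hode := planarPressureAM_hypergeometric_ode c hle hratio hx
  set X : ℝ := 16 * w * (1 - w) ^ 2 / (1 + w) ^ 4 with hX
  set g0 : ℝ := ∑' n, c n * X ^ n
  set g1 : ℝ := deriv (fun z : ℝ => ∑' n, c n * z ^ n) X
  set g2 : ℝ := deriv (deriv (fun z : ℝ => ∑' n, c n * z ^ n)) X
  have hw0 : (1 + w) ≠ 0 := h1.ne'
  have i1 : (w - 5 * w ^ 2 - 6 * w ^ 3 + 6 * w ^ 4 + 5 * w ^ 5 - w ^ 6)
      * (16 * (1 - w) * (1 - 6 * w + w ^ 2) / (1 + w) ^ 5) ^ 2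
      = 16 * (1 - w) * (1 - 6 * w + w ^ 2) * (X * (1 - X)) := by
    rw [hX]; field_simp; ring
  have i2 : (w - 5 * w ^ 2 - 6 * w ^ 3 + 6 * w ^ 4 + 5 * w ^ 5 - w ^ 6)
      * (32 * (w ^ 3 - 12 * w ^ 2 + 21 * w - 6) / (1 + w) ^ 6)
      + (1 - 15 * w + 12 * w ^ 2 + 24 * w ^ 3 - 5 * w ^ 4 - w ^ 5)
      * (16 * (1 - w) * (1 - 6 * w + w ^ 2) / (1 + w) ^ 5)
      = 16 * (1 - w) * (1 - 6 * w + w ^ 2) * (1 - 2 * X) := by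
    rw [hX]; field_simp; ring
  have key : (w - 5 * w ^ 2 - 6 * w ^ 3 + 6 * w ^ 4 + 5 * w ^ 5 - w ^ 6)
        * (g2 * (16 * (1 - w) * (1 - 6 * w + w ^ 2) / (1 + w) ^ 5)
            * (16 * (1 - w) * (1 - 6 * w + w ^ 2) / (1 + w) ^ 5)
          + g1 * (32 * (w ^ 3 - 12 * w ^ 2 + 21 * w - 6) / (1 + w) ^ 6))
      + (1 - 15 * w + 12 * w ^ 2 + 24 * w ^ 3 - 5 * w ^ 4 - w ^ 5)
        * (g1 * (16 * (1 - w) * (1 - 6 * w + w ^ 2) / (1 + w) ^ 5))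
      + (-4 + 28 * w - 28 * w ^ 2 + 4 * w ^ 3) * g0
      = 16 * (1 - w) * (1 - 6 * w + w ^ 2) * (X * (1 - X) * g2 + (1 - 2 * X) * g1 - g0 / 4) := by
    linear_combination g2 * i1 + g1 * i2
  rw [key, hode, mul_zero]

/-- `R(w) = log((1+w)/(1-w)) - Φ(x(w))/4` is analytic on `J`. [folklore] -/
theorem planarPressureAM_R_analyticAt (c : ℕ → ℝ) (hle : ∀ n, |c n| ≤ 1) {w : ℝ}
    (hw : w ∈ Ioo (-(1 / 32 : ℝ)) (3 - 2 * Real.sqrt 2)) :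
    AnalyticAt ℝ (fun w : ℝ => Real.log ((1 + w) / (1 - w))
      - (1 / 4) * ∑' n, (c n / n) * (16 * w * (1 - w) ^ 2 / (1 + w) ^ 4) ^ n) w := by
  obtain ⟨h1, h2, -, hx⟩ := planarPressureAM_J_facts hw
  have hP : AnalyticAt ℝ (fun z : ℝ => ∑' n, (c n / n) * z ^ n)
      (16 * w * (1 - w) ^ 2 / (1 + w) ^ 4) := by
    apply (planarPressureAM_Phi_onBall c hle).analyticAt_of_mem
    rw [Metric.mem_eball, edist_lt_ofReal, dist_zero_right, Real.norm_eq_abs]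
    exact hx
  have hxA : AnalyticAt ℝ (fun w : ℝ => 16 * w * (1 - w) ^ 2 / (1 + w) ^ 4) w := by
    fun_prop (disch := exact pow_ne_zero 4 h1.ne')
  have hcomp : AnalyticAt ℝ
      (fun w : ℝ => ∑' n, (c n / n) * (16 * w * (1 - w) ^ 2 / (1 + w) ^ 4) ^ n) w :=
    AnalyticAt.comp (g := fun z : ℝ => ∑' n, (c n / n) * z ^ n)
      (f := fun w : ℝ => 16 * w * (1 - w) ^ 2 / (1 + w) ^ 4) hP hxA
  have hlog : AnalyticAt ℝ (fun w : ℝ => Real.log ((1 + w) / (1 - w))) w := by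
    apply AnalyticAt.log
    · fun_prop (disch := exact h2.ne')
    · exact div_pos h1 h2
  have hconst : AnalyticAt ℝ (fun _ : ℝ => (1 / 4 : ℝ)) w := analyticAt_const
  exact hlog.sub (hconst.mul hcomp)

/-- The derivative relation for `R`: `4 w (1 - w²) R'(w) = 8 w - (1 - 6w + w²)(Y(w) - c₀)` on `J`.
[folklore] -/
theorem planarPressureAM_R_deriv (c : ℕ → ℝ) (hle : ∀ n, |c n| ≤ 1) {w : ℝ}
    (hw : w ∈ Ioo (-(1 / 32 : ℝ)) (3 - 2 * Real.sqrt 2)) :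
    4 * w * (1 - w ^ 2) * deriv (fun w : ℝ => Real.log ((1 + w) / (1 - w))
      - (1 / 4) * ∑' n, (c n / n) * (16 * w * (1 - w) ^ 2 / (1 + w) ^ 4) ^ n) w
      = 8 * w - (1 - 6 * w + w ^ 2)
        * ((∑' n, c n * (16 * w * (1 - w) ^ 2 / (1 + w) ^ 4) ^ n) - c 0) := by
  obtain ⟨h1, h2, -, hx⟩ := planarPressureAM_J_facts hw
  have hw2 : (1 - w ^ 2) ≠ 0 := by
    have : (1 - w ^ 2) = (1 - w) * (1 + w) := by ring
    rw [this]; exact mul_ne_zero h2.ne' h1.ne'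
  have h1' : (1 + w) ≠ 0 := h1.ne'
  have h2' : (1 - w) ≠ 0 := h2.ne'
  -- derivative of the log part
  have hu : HasDerivAt (fun w : ℝ => (1 + w) / (1 - w)) (2 / (1 - w) ^ 2) w := by
    have hn : HasDerivAt (fun w : ℝ => 1 + w) (0 + 1) w := (hasDerivAt_const w 1).add (hasDerivAt_id' w)
    have hd : HasDerivAt (fun w : ℝ => 1 - w) (0 - 1) w := (hasDerivAt_const w 1).sub (hasDerivAt_id' w)
    have := hn.div hd h2'
    refine this.congr_deriv ?_
    field_simp
    ring
  have hlog : HasDerivAt (fun w : ℝ => Real.log ((1 + w) / (1 - w))) (2 / (1 - w ^ 2)) w := by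
    have := hu.log (div_pos h1 h2).ne'
    refine this.congr_deriv ?_
    field_simp
    ring
  -- derivative of the Φ part
  have hmem : 16 * w * (1 - w) ^ 2 / (1 + w) ^ 4 ∈ Metric.eball (0 : ℝ) (ENNReal.ofReal 1) := by
    rw [Metric.mem_eball, edist_lt_ofReal, dist_zero_right, Real.norm_eq_abs]
    exact hx
  have hP : HasDerivAt (fun z : ℝ => ∑' n, (c n / n) * z ^ n)
      (deriv (fun z : ℝ => ∑' n, (c n / n) * z ^ n) (16 * w * (1 - w) ^ 2 / (1 + w) ^ 4))
      (16 * w * (1 - w) ^ 2 / (1 + w) ^ 4) :=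
    ((planarPressureAM_Phi_onBall c hle).analyticAt_of_mem hmem).differentiableAt.hasDerivAt
  have hcomp := hP.comp w (planarPressureAM_x_hasDerivAt w h1.ne')
  have hR : HasDerivAt (fun w : ℝ => Real.log ((1 + w) / (1 - w))
      - (1 / 4) * ∑' n, (c n / n) * (16 * w * (1 - w) ^ 2 / (1 + w) ^ 4) ^ n)
      (2 / (1 - w ^ 2) - (1 / 4) * (deriv (fun z : ℝ => ∑' n, (c n / n) * z ^ n)
        (16 * w * (1 - w) ^ 2 / (1 + w) ^ 4) * (16 * (1 - w) * (1 - 6 * w + w ^ 2) / (1 + w) ^ 5))) w :=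
    hlog.sub (hcomp.const_mul (1 / 4 : ℝ))
  rw [hR.deriv]
  have hΦ := planarPressureAM_mul_Phi_deriv c hle hx
  set X : ℝ := 16 * w * (1 - w) ^ 2 / (1 + w) ^ 4 with hX
  set d : ℝ := deriv (fun z : ℝ => ∑' n, (c n / n) * z ^ n) X
  -- `w x'(w) = x(w) (1-6w+w²)/(1-w²)`
  have i1 : 4 * w * (1 - w ^ 2) * (d * (16 * (1 - w) * (1 - 6 * w + w ^ 2) / (1 + w) ^ 5))
      = 4 * (1 - 6 * w + w ^ 2) * (X * d) := by
    rw [hX]; field_simp; ring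
  have i2 : 4 * w * (1 - w ^ 2) * (2 / (1 - w ^ 2)) = 8 * w := by
    field_simp
    ring
  calc 4 * w * (1 - w ^ 2) * (2 / (1 - w ^ 2)
        - 1 / 4 * (d * (16 * (1 - w) * (1 - 6 * w + w ^ 2) / (1 + w) ^ 5)))
      = 4 * w * (1 - w ^ 2) * (2 / (1 - w ^ 2))
        - (1 / 4) * (4 * w * (1 - w ^ 2) * (d * (16 * (1 - w) * (1 - 6 * w + w ^ 2) / (1 + w) ^ 5))) := by
          ring
    _ = 8 * w - (1 - 6 * w + w ^ 2) * (X * d) := by rw [i1, i2]; ring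
    _ = 8 * w - (1 - 6 * w + w ^ 2) * ((∑' n, c n * X ^ n) - c 0) := by rw [hΦ]

end Summit.CriticalPhenomena.Ising3DConformalLimit.Theorems
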